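import Mathlib
import HarnessLib

/-!
# Odd zeta values I: integral partial-fraction expansions

Arithmetic tool-kit for the proof that infinitely many of `ζ(3), ζ(5), ζ(7), …` are irrational
(Ball–Rivoal 2001; this tree's `infinite_setOf_irrational_zetaValue_odd`, discharged in
`PeriodsWave0Proofs.lean`). Following Ball–Rivoal (2001, Lemme 5), Zudilin (SIGMA 14 (2018) 028,
Lemma 1) and Fischler–Sprang–Zudilin (Compositio 155 (2019), Lemma 2), the rational functions
whose values at shifted integers produce linear forms in odd zeta values are *products of
rational functions with simple poles at `0, -1, …, -n` and integer residues*; such a product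
has a partial-fraction expansion `∑_{k ≤ n} ∑_{1 ≤ i ≤ p} c_{k,i} (t+k)^{-i}` whose coefficients
satisfy `d_n^{p-i} c_{k,i} ∈ ℤ`, `d_n = lcm(1, …, n)` (Mathlib's `Nat.lcmUpto`).

We package this as the predicate `IsExp n p f` ("`f` agrees, off the poles, with an expansion
of level `p`") and prove:

* closure under sums (`IsExp.add`, `IsExp.sum`), integer multiples, raising the level;
* `IsExp.mul_isSimple`: multiplying by one more simple-pole factor with integer residues
  raises the level by one — via the two-centre identity
  `1/(u^i (u+δ)) = ∑_{b<i} (-1)^b δ^{-(b+1)} u^{-(i-b)} + (-1)^i δ^{-i} (u+δ)^{-1}`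
  (`one_div_pow_mul`) and `δ = k' - k ∣ d_n`;
* `IsExp.mul_prod_isSimple`: the iterated version;
* the Lagrange formula `P(t)/∏_{k ≤ n}(t+k) = ∑_k (-1)^k P(-k) / (k!(n-k)!(t+k))` for
  `deg P ≤ n` (`eval_div_prod_eq_sum`, from Mathlib's barycentric Lagrange interpolation), and
  with it the three integer-residue building blocks of Fischler–Sprang–Zudilin (2019), §3:
  `n!/∏(t+k)`, `n!(t-R)/∏(t+k)` and `D^n ∏_{j=1}^{n}(t + A/D + j/D)/∏(t+k)` (`isSimple_G`,
  `isSimple_Gtilde`, `isSimple_F`), the last one by `n! ∣ ∏_{j<n}(N+j)` for every integer `N`.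

Everything here is elementary algebra; no analysis. All statements are about real-valued
functions of a real variable (the expansions are used at real points only).

## References
* [BallRivoal2001] K. Ball, T. Rivoal, Irrationalité d'une infinité de valeurs de la fonction
  zêta aux entiers impairs, Invent. Math. 146 (2001) 193–207, Lemme 5.
* [Zudilin2018] W. Zudilin, One of the odd zeta values from `ζ(5)` to `ζ(25)` is irrational. By
  elementary means, SIGMA 14 (2018) 028, Lemma 1 (arXiv:1801.09895).
* [FischlerSprangZudilin2019] S. Fischler, J. Sprang, W. Zudilin, Many odd zeta values are
  irrational, Compositio Math. 155 (2019) 938–952, §3 Lemma 2 (arXiv:1803.08905).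
-/

noncomputable section

open Finset Polynomial

open scoped Nat

namespace Literature.NumberTheory.Transcendental.OddZeta

/-! ### Integrality of real numbers -/

/-- `IsZ x`: the real number `x` is (the cast of) an integer. [folklore] -/
def IsZ (x : ℝ) : Prop := ∃ z : ℤ, x = z

namespace IsZ

/-- Integers are integral. [folklore] -/
theorem int (z : ℤ) : IsZ (z : ℝ) := ⟨z, rfl⟩

/-- Naturals are integral. [folklore] -/
theorem nat (n : ℕ) : IsZ (n : ℝ) := ⟨n, by simp⟩

/-- `0` is integral. [folklore] -/
theorem zero : IsZ 0 := ⟨0, by simp⟩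

/-- `1` is integral. [folklore] -/
theorem one : IsZ 1 := ⟨1, by simp⟩

/-- Sums of integral reals are integral. [folklore] -/
theorem add {x y : ℝ} (hx : IsZ x) (hy : IsZ y) : IsZ (x + y) := by
  obtain ⟨a, rfl⟩ := hx; obtain ⟨b, rfl⟩ := hy; exact ⟨a + b, by push_cast; ring⟩

/-- Negatives of integral reals are integral. [folklore] -/
theorem neg {x : ℝ} (hx : IsZ x) : IsZ (-x) := by
  obtain ⟨a, rfl⟩ := hx; exact ⟨-a, by push_cast; ring⟩

/-- Differences of integral reals are integral. [folklore] -/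
theorem sub {x y : ℝ} (hx : IsZ x) (hy : IsZ y) : IsZ (x - y) := by
  obtain ⟨a, rfl⟩ := hx; obtain ⟨b, rfl⟩ := hy; exact ⟨a - b, by push_cast; ring⟩

/-- Products of integral reals are integral. [folklore] -/
theorem mul {x y : ℝ} (hx : IsZ x) (hy : IsZ y) : IsZ (x * y) := by
  obtain ⟨a, rfl⟩ := hx; obtain ⟨b, rfl⟩ := hy; exact ⟨a * b, by push_cast; ring⟩

/-- Powers of integral reals are integral. [folklore] -/
theorem pow {x : ℝ} (hx : IsZ x) (n : ℕ) : IsZ (x ^ n) := by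
  obtain ⟨a, rfl⟩ := hx; exact ⟨a ^ n, by push_cast; ring⟩

/-- `(-1)^n` is integral. [folklore] -/
theorem neg_one_pow (n : ℕ) : IsZ ((-1 : ℝ) ^ n) := ⟨(-1) ^ n, by push_cast; ring⟩

/-- Finite sums of integral reals are integral. [folklore] -/
theorem sum {ι : Type*} (s : Finset ι) {f : ι → ℝ} (h : ∀ i ∈ s, IsZ (f i)) :
    IsZ (∑ i ∈ s, f i) := by
  classical
  induction s using Finset.induction_on with
  | empty => simpa using zero
  | insert a s ha ih =>
    rw [sum_insert ha]
    exact (h a (mem_insert_self a s)).add (ih fun i hi => h i (mem_insert_of_mem hi))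

/-- Finite products of integral reals are integral. [folklore] -/
theorem prod {ι : Type*} (s : Finset ι) {f : ι → ℝ} (h : ∀ i ∈ s, IsZ (f i)) :
    IsZ (∏ i ∈ s, f i) := by
  classical
  induction s using Finset.induction_on with
  | empty => simpa using one
  | insert a s ha ih =>
    rw [prod_insert ha]
    exact (h a (mem_insert_self a s)).mul (ih fun i hi => h i (mem_insert_of_mem hi))

/-- If the integer `a ≠ 0` divides the integer `b`, then `b / a` is integral. [folklore] -/
theorem of_dvd {a b : ℤ} (ha : a ≠ 0) (h : a ∣ b) : IsZ ((b : ℝ) / a) := by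
  obtain ⟨c, rfl⟩ := h
  refine ⟨c, ?_⟩
  have : (a : ℝ) ≠ 0 := by exact_mod_cast ha
  push_cast
  field_simp

/-- A non-zero integral real has absolute value at least `1`. [folklore] -/
theorem one_le_abs {x : ℝ} (hx : IsZ x) (h0 : x ≠ 0) : 1 ≤ |x| := by
  obtain ⟨a, rfl⟩ := hx
  have ha : a ≠ 0 := by rintro rfl; simp at h0
  rw [← Int.cast_abs]
  exact_mod_cast Int.one_le_abs ha

end IsZ

/-! ### `d_n = lcm(1, …, n)` -/

/-- `d_n = lcm(1,…,n)` as a real number (Mathlib's `Nat.lcmUpto`). [folklore] -/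
def dn (n : ℕ) : ℝ := (Nat.lcmUpto n : ℝ)

/-- `d_n > 0`. [folklore] -/
theorem dn_pos (n : ℕ) : 0 < dn n := by
  unfold dn; exact_mod_cast Nat.lcmUpto_pos n

/-- `d_n` is integral. [folklore] -/
theorem isZ_dn (n : ℕ) : IsZ (dn n) := IsZ.nat _

/-- `j ∣ d_n` for `1 ≤ j ≤ n`. [folklore] -/
theorem dvd_lcmUpto {j n : ℕ} (h1 : 1 ≤ j) (h2 : j ≤ n) : j ∣ Nat.lcmUpto n := by
  have : j ∈ Icc 1 n := mem_Icc.2 ⟨h1, h2⟩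
  have h := Finset.dvd_lcm (f := id) this
  simpa [Nat.lcmUpto] using h

/-- For an integer `δ` with `1 ≤ |δ| ≤ n`, `d_n / δ` is an integer. [folklore] -/
theorem isZ_dn_div {n : ℕ} {δ : ℤ} (h0 : δ ≠ 0) (hle : δ.natAbs ≤ n) : IsZ (dn n / δ) := by
  have h1 : 1 ≤ δ.natAbs := Int.natAbs_pos.2 h0
  have hd : (δ.natAbs : ℤ) ∣ (Nat.lcmUpto n : ℤ) := by
    exact_mod_cast dvd_lcmUpto h1 hle
  have hd' : δ ∣ (Nat.lcmUpto n : ℤ) := Int.natAbs_dvd.1 hd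
  have := IsZ.of_dvd h0 hd'
  simpa [dn] using this

/-- The difference of two distinct centres `k ≠ k'` in `[0, n]` divides `d_n`:
`d_n / (k' - k)` is an integer. [folklore] -/
theorem isZ_dn_div_sub {n k k' : ℕ} (hk : k ≤ n) (hk' : k' ≤ n) (hne : k ≠ k') :
    IsZ (dn n / ((k' : ℝ) - k)) := by
  have h0 : ((k' : ℤ) - k) ≠ 0 := by omega
  have hle : ((k' : ℤ) - k).natAbs ≤ n := by omega
  have := isZ_dn_div h0 hle
  push_cast at this
  exact this

/-! ### Expansions -/

/-- `Good n t`: the real point `t` is not one of the poles `0, -1, …, -n`. [folklore] -/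
def Good (n : ℕ) (t : ℝ) : Prop := ∀ k : ℕ, k ≤ n → t + k ≠ 0

/-- Positive points are good. [folklore] -/
theorem good_of_pos {n : ℕ} {t : ℝ} (ht : 0 < t) : Good n t :=
  fun k _ => by positivity

/-- Points below `-n` are good. [folklore] -/
theorem good_of_lt_neg {n : ℕ} {t : ℝ} (ht : t < -n) : Good n t := by
  intro k hk h
  have : (k : ℝ) ≤ n := by exact_mod_cast hk
  linarith

/-- Evaluation of the finite partial-fraction expansion with centres `0,…,n`, pole orders
`1,…,p` and coefficients `c k i`. [folklore] -/
def pfEval (n p : ℕ) (c : ℕ → ℕ → ℝ) (t : ℝ) : ℝ :=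
  ∑ k ∈ range (n + 1), ∑ i ∈ Icc 1 p, c k i / (t + k) ^ i

/-- `IsExp n p f`: off the poles, `f` is given by a partial-fraction expansion with centres
`0,…,n`, pole orders `≤ p`, and coefficients with `d_n^{p-i} c_{k,i} ∈ ℤ` — the integrality
pattern of Zudilin (2018), Lemma 1. [cite: Zudilin2018OddZeta, Lemma 1] -/
def IsExp (n p : ℕ) (f : ℝ → ℝ) : Prop :=
  ∃ c : ℕ → ℕ → ℝ, (∀ k i, IsZ (dn n ^ (p - i) * c k i)) ∧
    ∀ t, Good n t → f t = pfEval n p c t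

namespace IsExp

variable {n p : ℕ} {f g : ℝ → ℝ}

/-- `IsExp` only depends on the values off the poles. [folklore] -/
theorem congr (h : IsExp n p f) (hfg : ∀ t, Good n t → g t = f t) : IsExp n p g := by
  obtain ⟨c, hc, hf⟩ := h
  exact ⟨c, hc, fun t ht => (hfg t ht).trans (hf t ht)⟩

/-- The zero function is an expansion of every level. [folklore] -/
theorem zero : IsExp n p (fun _ => 0) :=
  ⟨fun _ _ => 0, fun _ _ => by simpa using IsZ.zero, fun t _ => by simp [pfEval]⟩

/-- Sums of expansions of level `p` are expansions of level `p`. [folklore] -/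
theorem add (hf : IsExp n p f) (hg : IsExp n p g) : IsExp n p (fun t => f t + g t) := by
  obtain ⟨c, hc, hf⟩ := hf
  obtain ⟨c', hc', hg⟩ := hg
  refine ⟨fun k i => c k i + c' k i, fun k i => ?_, fun t ht => ?_⟩
  · rw [mul_add]; exact (hc k i).add (hc' k i)
  · beta_reduce
    rw [hf t ht, hg t ht, pfEval, pfEval, pfEval, ← sum_add_distrib]
    refine sum_congr rfl fun k _ => ?_
    rw [← sum_add_distrib]
    refine sum_congr rfl fun i _ => ?_
    ring

/-- Finite sums of expansions of level `p` are expansions of level `p`. [folklore] -/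
theorem sum {ι : Type*} (s : Finset ι) {F : ι → ℝ → ℝ} (h : ∀ j ∈ s, IsExp n p (F j)) :
    IsExp n p (fun t => ∑ j ∈ s, F j t) := by
  classical
  induction s using Finset.induction_on with
  | empty => exact (zero : IsExp n p fun _ => 0).congr fun t _ => by simp
  | insert a s ha ih =>
    have h1 := (h a (mem_insert_self a s)).add (ih fun j hj => h j (mem_insert_of_mem hj))
    refine h1.congr fun t _ => ?_
    rw [sum_insert ha]

/-- Real multiples by an integral real preserve the level. [folklore] -/
theorem mul_isZ (hf : IsExp n p f) {z : ℝ} (hz : IsZ z) : IsExp n p (fun t => z * f t) := by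
  obtain ⟨c, hc, hf⟩ := hf
  refine ⟨fun k i => z * c k i, fun k i => ?_, fun t ht => ?_⟩
  · have := (hc k i).mul hz
    convert this using 1; ring
  · beta_reduce
    rw [hf t ht, pfEval, pfEval, mul_sum]
    refine sum_congr rfl fun k _ => ?_
    rw [mul_sum]
    refine sum_congr rfl fun i _ => ?_
    ring

/-- Raising the level. [folklore] -/
theorem mono (hf : IsExp n p f) {p' : ℕ} (hp : p ≤ p') : IsExp n p' f := by
  obtain ⟨c, hc, hf⟩ := hf
  refine ⟨fun k i => if i ≤ p then c k i else 0, fun k i => ?_, fun t ht => ?_⟩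
  · by_cases hi : i ≤ p
    · simp only [hi, if_true]
      have e : p' - i = (p' - p) + (p - i) := by omega
      rw [e, pow_add, mul_assoc]
      exact ((isZ_dn n).pow _).mul (hc k i)
    · simp only [hi, if_false, mul_zero]; exact IsZ.zero
  · rw [hf t ht, pfEval, pfEval]
    refine sum_congr rfl fun k _ => ?_
    have hsub : Icc 1 p ⊆ Icc 1 p' := Icc_subset_Icc le_rfl hp
    rw [← sum_subset hsub]
    · refine sum_congr rfl fun i hi => ?_
      rw [if_pos (mem_Icc.1 hi).2]
    · intro i hi hi'
      have : ¬ i ≤ p := fun h => hi' (mem_Icc.2 ⟨(mem_Icc.1 hi).1, h⟩)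
      simp [this]

end IsExp

/-- A single term `a/(t+k)^i` with `k ≤ n`, `1 ≤ i ≤ p` and `d_n^{p-i} a ∈ ℤ` is an expansion of
level `p`. [folklore] -/
theorem isExp_single {n p k i : ℕ} {a : ℝ} (hk : k ≤ n) (hi1 : 1 ≤ i) (hip : i ≤ p)
    (ha : IsZ (dn n ^ (p - i) * a)) : IsExp n p (fun t => a / (t + k) ^ i) := by
  classical
  refine ⟨fun k' i' => if k' = k ∧ i' = i then a else 0, fun k' i' => ?_, fun t _ => ?_⟩
  · beta_reduce
    by_cases h : k' = k ∧ i' = i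
    · rw [if_pos h, h.2]; exact ha
    · rw [if_neg h, mul_zero]; exact IsZ.zero
  · beta_reduce
    rw [pfEval]
    rw [sum_eq_single_of_mem k (mem_range.2 (by omega))]
    · rw [sum_eq_single_of_mem i (mem_Icc.2 ⟨hi1, hip⟩)]
      · simp
      · intro i' _ hi'
        simp [hi']
    · intro k' _ hk'
      refine sum_eq_zero fun i' _ => ?_
      simp [hk']

/-! ### The two-centre identity -/

/-- **Two-centre partial fractions.** For `u ≠ 0`, `u + δ ≠ 0`, `δ ≠ 0`:
`1/(u^i (u+δ)) = ∑_{b<i} (-1)^b / (δ^{b+1} u^{i-b}) + (-1)^i/(δ^i (u+δ))`. [folklore] -/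
theorem one_div_pow_mul (u δ : ℝ) (hu : u ≠ 0) (hv : u + δ ≠ 0) (hδ : δ ≠ 0) (i : ℕ) :
    1 / (u ^ i * (u + δ)) =
      ∑ b ∈ range i, (-1) ^ b / (δ ^ (b + 1) * u ^ (i - b)) + (-1) ^ i / (δ ^ i * (u + δ)) := by
  induction i with
  | zero => simp
  | succ i ih =>
    have step : 1 / (u ^ (i + 1) * (u + δ)) = (1 / u) * (1 / (u ^ i * (u + δ))) := by
      field_simp; ring
    rw [step, ih, mul_add, mul_sum, sum_range_succ]
    have key : 1 / u * ((-1) ^ i / (δ ^ i * (u + δ))) =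
        (-1) ^ i / (δ ^ (i + 1) * u ^ (i + 1 - i)) + (-1) ^ (i + 1) / (δ ^ (i + 1) * (u + δ)) := by
      rw [show i + 1 - i = 1 by omega]
      field_simp
      ring
    have hS : ∑ b ∈ range i, 1 / u * ((-1) ^ b / (δ ^ (b + 1) * u ^ (i - b))) =
        ∑ b ∈ range i, (-1) ^ b / (δ ^ (b + 1) * u ^ (i + 1 - b)) := by
      refine sum_congr rfl fun b hb => ?_
      have hb' : b < i := mem_range.1 hb
      rw [show i + 1 - b = (i - b) + 1 by omega, pow_succ]
      field_simp
      ring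
    rw [key, hS]
    ring

/-- The cross term `a e /((t+k)^i (t+k'))` (`k ≠ k'` centres in `[0,n]`, `1 ≤ i ≤ p`,
`d_n^{p-i} a ∈ ℤ`, `e ∈ ℤ`) is an expansion of level `p + 1`: the two-centre identity produces
denominators `(k'-k)^{j}` which divide `d_n^{j}`. [cite: Zudilin2018OddZeta, Lemma 1] -/
theorem isExp_cross {n p k k' i : ℕ} {a e : ℝ} (hk : k ≤ n) (hk' : k' ≤ n) (hne : k ≠ k')
    (hip : i ≤ p) (ha : IsZ (dn n ^ (p - i) * a)) (he : IsZ e) :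
    IsExp n (p + 1) (fun t => a * e / ((t + k) ^ i * (t + k'))) := by
  set δ : ℝ := (k' : ℝ) - k with hδ
  have hδ0 : δ ≠ 0 := by
    rw [hδ]; intro h
    have : (k' : ℝ) = k := by linarith
    exact hne (by exact_mod_cast this.symm)
  have hq : IsZ (dn n / δ) := isZ_dn_div_sub hk hk' hne
  -- the main terms
  have h1 : IsExp n (p + 1) (fun t => ∑ b ∈ range i,
      (a * e * (-1) ^ b / δ ^ (b + 1)) / (t + k) ^ (i - b)) := by
    refine IsExp.sum _ fun b hb => ?_
    have hb' : b < i := mem_range.1 hb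
    refine isExp_single hk (by omega) (by omega) ?_
    have e1 : p + 1 - (i - b) = (p - i) + (b + 1) := by omega
    have : dn n ^ (p + 1 - (i - b)) * (a * e * (-1) ^ b / δ ^ (b + 1)) =
        (dn n ^ (p - i) * a) * e * (-1) ^ b * (dn n / δ) ^ (b + 1) := by
      rw [e1, pow_add, div_pow]; ring
    rw [this]
    exact ((ha.mul he).mul (IsZ.neg_one_pow b)).mul (hq.pow _)
  -- the last term
  have h2 : IsExp n (p + 1) (fun t => (a * e * (-1) ^ i / δ ^ i) / (t + k') ^ 1) := by
    refine isExp_single hk' le_rfl (by omega) ?_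
    have : dn n ^ (p + 1 - 1) * (a * e * (-1) ^ i / δ ^ i) =
        (dn n ^ (p - i) * a) * e * (-1) ^ i * (dn n / δ) ^ i := by
      rw [show p + 1 - 1 = (p - i) + i by omega, pow_add, div_pow]; ring
    rw [this]
    exact ((ha.mul he).mul (IsZ.neg_one_pow i)).mul (hq.pow _)
  refine (h1.add h2).congr fun t ht => ?_
  have hu : t + k ≠ 0 := ht k hk
  have hv : t + k + δ ≠ 0 := by
    have := ht k' hk'
    rw [hδ]; convert this using 1; ring
  have hid := one_div_pow_mul (t + k) δ hu hv hδ0 i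
  have ev : t + k + δ = t + k' := by rw [hδ]; ring
  rw [ev] at hid
  calc a * e / ((t + ↑k) ^ i * (t + ↑k'))
      = a * e * (1 / ((t + ↑k) ^ i * (t + ↑k'))) := by rw [mul_one_div]
    _ = a * e * (∑ b ∈ range i, (-1) ^ b / (δ ^ (b + 1) * (t + k) ^ (i - b))
          + (-1) ^ i / (δ ^ i * (t + k'))) := by rw [hid]
    _ = _ := by
      rw [mul_add, mul_sum, pow_one]
      congr 1
      · refine sum_congr rfl fun b _ => ?_
        field_simp
      · field_simp

/-! ### Simple factors and products -/

/-- `IsSimple n g`: off the poles, `g t = ∑_{k ≤ n} e_k/(t+k)` with integer residues `e_k`.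
[folklore] -/
def IsSimple (n : ℕ) (g : ℝ → ℝ) : Prop :=
  ∃ e : ℕ → ℤ, ∀ t, Good n t → g t = ∑ k ∈ range (n + 1), (e k : ℝ) / (t + k)

/-- A simple factor is an expansion of level `1`. [folklore] -/
theorem IsSimple.isExp {n : ℕ} {g : ℝ → ℝ} (hg : IsSimple n g) : IsExp n 1 g := by
  obtain ⟨e, he⟩ := hg
  have h : IsExp n 1 (fun t => ∑ k ∈ range (n + 1), (e k : ℝ) / (t + k) ^ 1) := by
    refine IsExp.sum _ fun k hk => ?_
    refine isExp_single (by simpa [Nat.lt_succ_iff] using hk) le_rfl le_rfl ?_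
    simpa using IsZ.int (e k)
  refine h.congr fun t ht => ?_
  rw [he t ht]
  simp

/-- **Product step** (Zudilin 2018, Lemma 1; Fischler–Sprang–Zudilin 2019, proof of Lemma 2):
an expansion of level `p` times a simple factor with integer residues is an expansion of level
`p + 1`. [cite: Zudilin2018OddZeta, Lemma 1] -/
theorem IsExp.mul_isSimple {n p : ℕ} {f g : ℝ → ℝ} (hf : IsExp n p f) (hg : IsSimple n g) :
    IsExp n (p + 1) (fun t => f t * g t) := by
  obtain ⟨c, hc, hf⟩ := hf
  obtain ⟨e, he⟩ := hg
  -- each elementary product is an expansion of level `p + 1`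
  have hterm : ∀ k ∈ range (n + 1), ∀ i ∈ Icc 1 p, ∀ k' ∈ range (n + 1),
      IsExp n (p + 1) (fun t => c k i * e k' / ((t + k) ^ i * (t + k'))) := by
    intro k hk i hi k' hk'
    have hkn : k ≤ n := by simpa [Nat.lt_succ_iff] using hk
    have hkn' : k' ≤ n := by simpa [Nat.lt_succ_iff] using hk'
    obtain ⟨hi1, hip⟩ := mem_Icc.1 hi
    by_cases hkk : k = k'
    · subst hkk
      have h1 : IsExp n (p + 1) (fun t => (c k i * e k) / (t + k) ^ (i + 1)) := by
        refine isExp_single hkn (by omega) (by omega) ?_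
        rw [show p + 1 - (i + 1) = p - i by omega, ← mul_assoc]
        exact (hc k i).mul (IsZ.int _)
      refine h1.congr fun t _ => ?_
      rw [pow_succ]
    · exact isExp_cross hkn hkn' hkk hip (hc k i) (IsZ.int _)
  have hsum : IsExp n (p + 1) (fun t => ∑ k ∈ range (n + 1), ∑ i ∈ Icc 1 p,
      ∑ k' ∈ range (n + 1), c k i * e k' / ((t + k) ^ i * (t + k'))) :=
    IsExp.sum _ fun k hk => IsExp.sum _ fun i hi => IsExp.sum _ fun k' hk' => hterm k hk i hi k' hk'
  refine hsum.congr fun t ht => ?_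
  rw [hf t ht, he t ht, pfEval, sum_mul]
  refine sum_congr rfl fun k hk => ?_
  rw [sum_mul]
  refine sum_congr rfl fun i _ => ?_
  rw [mul_sum]
  refine sum_congr rfl fun k' hk' => ?_
  have h1 : t + k ≠ 0 := ht k (by simpa [Nat.lt_succ_iff] using hk)
  have h2 : t + k' ≠ 0 := ht k' (by simpa [Nat.lt_succ_iff] using hk')
  field_simp

/-- Iterated product step: an expansion of level `p` times `m` simple factors is an expansion
of level `p + m`. [cite: Zudilin2018OddZeta, Lemma 1] -/
theorem IsExp.mul_prod_isSimple {n p : ℕ} {f : ℝ → ℝ} (hf : IsExp n p f) {ι : Type*}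
    (s : Finset ι) {g : ι → ℝ → ℝ} (hg : ∀ j ∈ s, IsSimple n (g j)) :
    IsExp n (p + s.card) (fun t => f t * ∏ j ∈ s, g j t) := by
  classical
  induction s using Finset.induction_on with
  | empty => simpa using hf
  | insert a s ha ih =>
    have h1 := (ih fun j hj => hg j (mem_insert_of_mem hj)).mul_isSimple
      (hg a (mem_insert_self a s))
    rw [card_insert_of_notMem ha, ← add_assoc]
    refine h1.congr fun t _ => ?_
    rw [prod_insert ha]
    ring

/-! ### The Lagrange formula and the three building blocks -/

/-- `∏_{j<k} (k - j) = k!`. [folklore] -/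
theorem prod_range_sub_eq_factorial (k : ℕ) : ∏ j ∈ range k, ((k : ℝ) - j) = k ! := by
  induction k with
  | zero => simp
  | succ k ih =>
    rw [prod_range_succ', Nat.factorial_succ]
    push_cast
    have : ∏ j ∈ range k, ((k : ℝ) + 1 - ((j : ℝ) + 1)) = ∏ j ∈ range k, ((k : ℝ) - j) :=
      prod_congr rfl fun j _ => by ring
    rw [this, ih]
    ring

/-- `∏_{j ∈ [0,n], j ≠ k} (j - k) = (-1)^k k! (n-k)!`. [folklore] -/
theorem prod_erase_sub (n k : ℕ) (hk : k ≤ n) :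
    ∏ j ∈ (range (n + 1)).erase k, ((j : ℝ) - k) = (-1) ^ k * k ! * (n - k)! := by
  have hsplit : (range (n + 1)).erase k = range k ∪ Ico (k + 1) (n + 1) := by
    ext j
    simp only [mem_erase, mem_range, mem_union, mem_Ico]
    omega
  have hdisj : Disjoint (range k) (Ico (k + 1) (n + 1)) := by
    rw [disjoint_left]
    intro j hj hj'
    simp only [mem_range] at hj
    simp only [mem_Ico] at hj'
    omega
  rw [hsplit, prod_union hdisj]
  have h1 : ∏ j ∈ range k, ((j : ℝ) - k) = (-1) ^ k * k ! := by
    have : ∏ j ∈ range k, ((j : ℝ) - k) = ∏ j ∈ range k, ((-1 : ℝ) * ((k : ℝ) - j)) :=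
      prod_congr rfl fun j _ => by ring
    rw [this, prod_mul_distrib, prod_const, card_range, prod_range_sub_eq_factorial]
  have h2 : ∏ j ∈ Ico (k + 1) (n + 1), ((j : ℝ) - k) = (n - k)! := by
    rw [prod_Ico_eq_prod_range, show n + 1 - (k + 1) = n - k by omega,
      ← prod_range_add_one_eq_factorial (n - k)]
    push_cast
    refine prod_congr rfl fun j _ => ?_
    ring
  rw [h1, h2]

/-- **Lagrange.** For a real polynomial `P` of degree `≤ n` and `t` off the poles,
`P(t)/∏_{k ≤ n}(t+k) = ∑_{k ≤ n} ((-1)^k/(k!(n-k)!)) P(-k)/(t+k)` (Mathlib's barycentric form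
of Lagrange interpolation at the nodes `0,-1,…,-n`). [folklore] -/
theorem eval_div_prod_eq_sum {n : ℕ} (P : ℝ[X]) (hP : P.natDegree ≤ n) (t : ℝ) (ht : Good n t) :
    P.eval t / ∏ k ∈ range (n + 1), (t + k) =
      ∑ k ∈ range (n + 1), ((-1) ^ k / (k ! * (n - k)!) * P.eval (-(k : ℝ))) / (t + k) := by
  classical
  set v : ℕ → ℝ := fun i => -(i : ℝ) with hv
  have hvs : Set.InjOn v (range (n + 1) : Finset ℕ) := by
    intro a _ b _ h
    simp only [hv, neg_inj, Nat.cast_inj] at h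
    exact h
  have hdeg : P.degree < #(range (n + 1)) := by
    rw [card_range]
    exact lt_of_le_of_lt (degree_le_natDegree) (by exact_mod_cast Nat.lt_succ_of_le hP)
  have hx : ∀ i ∈ range (n + 1), t ≠ v i := by
    intro i hi h
    have := ht i (by simpa [Nat.lt_succ_iff] using hi)
    rw [h, hv] at this
    simp at this
  have hP' := Lagrange.eq_interpolate (f := P) hvs hdeg
  have hev := Lagrange.eval_interpolate_not_at_node (fun i => P.eval (v i)) hx
  rw [← hP'] at hev
  have hnodal : eval t (Lagrange.nodal (range (n + 1)) v) = ∏ k ∈ range (n + 1), (t + k) := by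
    rw [Lagrange.eval_nodal]
    refine prod_congr rfl fun k _ => ?_
    rw [hv]; ring
  have hprod : ∏ k ∈ range (n + 1), (t + k) ≠ 0 :=
    prod_ne_zero_iff.2 fun k hk => ht k (by simpa [Nat.lt_succ_iff] using hk)
  rw [hev, hnodal, mul_div_cancel_left₀ _ hprod]
  refine sum_congr rfl fun k hk => ?_
  have hkn : k ≤ n := by simpa [Nat.lt_succ_iff] using hk
  have hw : Lagrange.nodalWeight (range (n + 1)) v k = (-1) ^ k / (k ! * (n - k)!) := by
    rw [Lagrange.nodalWeight]
    have : ∏ j ∈ (range (n + 1)).erase k, (v k - v j)⁻¹ =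
        (∏ j ∈ (range (n + 1)).erase k, ((j : ℝ) - k))⁻¹ := by
      rw [← prod_inv_distrib]
      refine prod_congr rfl fun j _ => ?_
      rw [hv]; ring
    rw [this, prod_erase_sub n k hkn]
    have h1 : ((-1 : ℝ) ^ k)⁻¹ = (-1) ^ k := by
      rw [← inv_pow, inv_neg, inv_one]
    rw [mul_assoc, mul_inv, h1, div_eq_mul_inv]
  rw [hw, hv]
  simp only
  rw [sub_neg_eq_add, div_eq_mul_inv]
  ring

/-- `n! ∣ ∏_{j<n} (N + j)` for every integer `N`. [folklore] -/
theorem factorial_dvd_prod_add (N : ℤ) (n : ℕ) : (n ! : ℤ) ∣ ∏ j ∈ range n, (N + j) := by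
  have h1 : ∏ j ∈ range n, (N + j) = (descPochhammer ℤ n).eval (N + n - 1) := by
    rw [descPochhammer_eval_eq_prod_range, ← prod_range_reflect]
    refine prod_congr rfl fun j hj => ?_
    have hj' : j < n := mem_range.1 hj
    push_cast [Nat.cast_sub (by omega : j ≤ n - 1), Nat.cast_sub (by omega : 1 ≤ n)]
    ring
  rw [h1]
  have h := Ring.descPochhammer_eq_factorial_smul_choose (R := ℤ) (N + n - 1) n
  rw [← Polynomial.eval_eq_smeval] at h
  rw [h, nsmul_eq_mul]
  exact dvd_mul_right _ _

/-- `(-1)^k n!/(k!(n-k)!) = (-1)^k C(n,k)`. [folklore] -/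
theorem factorial_div_eq_choose {n k : ℕ} (hk : k ≤ n) :
    ((n ! : ℝ)) / (k ! * (n - k)!) = (n.choose k : ℝ) := by
  rw [Nat.cast_choose ℝ hk]

/-- **Building block `G`** (FSZ 2019, §3): `n!/∏_{k ≤ n}(t+k) = ∑_k (-1)^k C(n,k)/(t+k)`.
[cite: FischlerSprangZudilin2019, §3 (function G)] -/
theorem isSimple_G (n : ℕ) : IsSimple n (fun t => (n ! : ℝ) / ∏ k ∈ range (n + 1), (t + k)) := by
  refine ⟨fun k => (-1) ^ k * (n.choose k : ℤ), fun t ht => ?_⟩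
  have h := eval_div_prod_eq_sum (n := n) (C (n ! : ℝ)) (by simp) t ht
  simp only [eval_C] at h
  beta_reduce
  rw [h]
  refine sum_congr rfl fun k hk => ?_
  have hkn : k ≤ n := by simpa [Nat.lt_succ_iff] using hk
  have e : (((-1 : ℤ) ^ k * (n.choose k : ℤ) : ℤ) : ℝ) = (-1) ^ k * ((n ! : ℝ) / (k ! * (n - k)!)) := by
    push_cast
    rw [factorial_div_eq_choose hkn]
  rw [e]
  congr 1
  ring

/-- **Building block `G̃`**: `n!(t-R)/∏_{k ≤ n}(t+k) = ∑_k (-1)^{k+1} C(n,k)(k+R)/(t+k)` for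
`n ≥ 1` (the factor `t - rn` of the Ball–Rivoal numerator absorbed into `G`, using
`∑_k (-1)^k C(n,k) = 0`). [cite: FischlerSprangZudilin2019, §3 (eq. for R_n as a product)] -/
theorem isSimple_Gtilde (n R : ℕ) (hn : 1 ≤ n) :
    IsSimple n (fun t => (n ! : ℝ) * (t - R) / ∏ k ∈ range (n + 1), (t + k)) := by
  refine ⟨fun k => (-1) ^ (k + 1) * (n.choose k : ℤ) * (k + R), fun t ht => ?_⟩
  have hdeg : (C (n ! : ℝ) * (X - C (R : ℝ))).natDegree ≤ n := by
    refine (natDegree_C_mul_le _ _).trans ?_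
    rw [natDegree_X_sub_C]
    exact hn
  have h := eval_div_prod_eq_sum (n := n) (C (n ! : ℝ) * (X - C (R : ℝ))) hdeg t ht
  simp only [eval_mul, eval_C, eval_sub, eval_X] at h
  beta_reduce
  rw [h]
  refine sum_congr rfl fun k hk => ?_
  have hkn : k ≤ n := by simpa [Nat.lt_succ_iff] using hk
  have e : (((-1 : ℤ) ^ (k + 1) * (n.choose k : ℤ) * (k + R) : ℤ) : ℝ) =
      (-1) ^ (k + 1) * ((n ! : ℝ) / (k ! * (n - k)!)) * (k + R) := by
    push_cast
    rw [factorial_div_eq_choose hkn]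
  rw [e]
  congr 1
  ring

/-- **Building block `F`** (FSZ 2019, §3, `F_α` with `α = A/D`):
`D^n ∏_{j=1}^{n}(t + A/D + j/D)/∏_{k ≤ n}(t+k)` has integer residues
`(-1)^k C(n,k) ∏_{j=1}^{n}(A - Dk + j)/n!`. [cite: FischlerSprangZudilin2019, §3 (coefficients A_{α,k})] -/
theorem isSimple_F (n D : ℕ) (hD : 0 < D) (A : ℤ) :
    IsSimple n (fun t => (D : ℝ) ^ n * (∏ j ∈ range n, (t + (A : ℝ) / D + ((j : ℝ) + 1) / D)) /
      ∏ k ∈ range (n + 1), (t + k)) := by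
  have hD' : (D : ℝ) ≠ 0 := by exact_mod_cast hD.ne'
  -- the integer quotients
  have hdvd : ∀ k : ℕ, (n ! : ℤ) ∣ ∏ j ∈ range n, ((A - D * k + 1) + j) := fun k =>
    factorial_dvd_prod_add _ n
  refine ⟨fun k => (-1) ^ k * (n.choose k : ℤ) * ((∏ j ∈ range n, ((A - D * k + 1) + j)) / n !),
    fun t ht => ?_⟩
  set P : ℝ[X] := C ((D : ℝ) ^ n) * ∏ j ∈ range n, (X + C ((A : ℝ) / D + ((j : ℝ) + 1) / D))
    with hP
  have hdeg : P.natDegree ≤ n := by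
    refine (natDegree_C_mul_le _ _).trans ?_
    refine (natDegree_prod_le _ _).trans ?_
    have : ∀ j ∈ range n, (X + C ((A : ℝ) / D + ((j : ℝ) + 1) / D)).natDegree ≤ 1 := by
      intro j _
      rw [natDegree_X_add_C]
    calc ∑ j ∈ range n, (X + C ((A : ℝ) / D + ((j : ℝ) + 1) / D)).natDegree
        ≤ ∑ _j ∈ range n, (1 : ℕ) :=
          sum_le_sum (f := fun j : ℕ => (X + C ((A : ℝ) / D + ((j : ℝ) + 1) / D)).natDegree) this
      _ = n := by simp
  have h := eval_div_prod_eq_sum (n := n) P hdeg t ht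
  have hevt : P.eval t = (D : ℝ) ^ n * ∏ j ∈ range n, (t + (A : ℝ) / D + ((j : ℝ) + 1) / D) := by
    rw [hP, eval_mul, eval_C, eval_prod]
    congr 1
    refine prod_congr rfl fun j _ => ?_
    simp only [eval_add, eval_X, eval_C]
    ring
  rw [hevt] at h
  beta_reduce
  rw [h]
  refine sum_congr rfl fun k hk => ?_
  have hkn : k ≤ n := by simpa [Nat.lt_succ_iff] using hk
  -- evaluate `P(-k)`
  have hevk : P.eval (-(k : ℝ)) = ((∏ j ∈ range n, ((A - D * k + 1) + j) : ℤ) : ℝ) := by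
    rw [hP, eval_mul, eval_C, eval_prod]
    push_cast
    have hDn : (D : ℝ) ^ n = ∏ _j ∈ range n, (D : ℝ) := by rw [prod_const, card_range]
    rw [hDn, ← prod_mul_distrib]
    refine prod_congr rfl fun j _ => ?_
    simp only [eval_add, eval_X, eval_C]
    field_simp
    ring
  obtain ⟨q, hq⟩ := hdvd k
  have hq' : (∏ j ∈ range n, ((A - D * k + 1) + j)) / (n ! : ℤ) = q := by
    rw [hq]
    exact Int.mul_ediv_cancel_left _ (by exact_mod_cast (Nat.factorial_pos n).ne')
  have e : (((-1 : ℤ) ^ k * (n.choose k : ℤ) * ((∏ j ∈ range n, ((A - D * k + 1) + j)) / n !) : ℤ)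
      : ℝ) = (-1) ^ k / (k ! * (n - k)!) * P.eval (-(k : ℝ)) := by
    rw [hq', hevk, hq]
    push_cast
    rw [← factorial_div_eq_choose hkn]
    ring
  rw [e]

end Literature.NumberTheory.Transcendental.OddZeta
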